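import Summits.Langlands.Langlands.Theses.EisensteinGelfandKirillov
import Literature.NumberTheory.Automorphic.ResGLnCohomology
import Literature.NumberTheory.Automorphic.ResGL2EigensystemCuspidalOrEisenstein
import Literature.NumberTheory.Automorphic.GL2TowerTorsionRelationsClassical
import Literature.NumberTheory.Automorphic.ResGLnCohomologyRationalRelations
import Summits.Langlands.Langlands.Theorems.EisensteinGelfandKirillovCrystallineProModularClassicalDefs
import Summits.Langlands.Langlands.Theorems.EisensteinGelfandKirillovCrystallineProModularClassicalExactOccupancy
import Summits.Langlands.Langlands.Theorems.EisensteinGelfandKirillovCrystallineProModularClassicalFiniteDimensionalLevelCohomology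
import Summits.Langlands.Langlands.Theorems.EisensteinGelfandKirillovCrystallineProModularClassicalEichlerShimuraHarder
import Summits.Langlands.Langlands.Theorems.EisensteinGelfandKirillovCrystallineProModularClassicalTameLevelStripping
import Summits.Langlands.Langlands.Theorems.ProModularOrdinaryClassical.Negative.FrobeniusIntegrality
import Summits.Langlands.Langlands.Theorems.CrystallineProModularClassical.Negative.LoadBearing

/-!
# Line `torsion-weight-exchange` for the crux `EisensteinGelfandKirillov.CrystallineProModularClassical`
(stmt-Langlands-18274, THE EXIT of route EisensteinGelfandKirillov) — planner's CHECKED SKELETON rev 1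
(planner-cruxplan-stmt-Langlands-18274-torsion-weight-excha-0, 2026-08-17); LEAD rev 2 (prover-line-stmt-Langlands-18274-a2-0,
2026-08-17: S4 split into `stub_finiteDimensional_levelCohomology` (Borel–Serre debt) + `stub_exactOccupancy` (pure algebra,
finite-dimensionality as hypothesis); composition unchanged otherwise).

Source: crux idea `Cruxes/CrystallineProModularClassical/Ideas/torsion-weight-exchange.md` (crux-ideate r2 k5,
"Liu's mirror"), triage `TRIAGE-r2-1.md` / `TRIAGE-r2-2.md` (pass ×2, sharpenings acted on below); line card
`Lines/torsion-weight-exchange.md`.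

**Idea in one paragraph.** `TameLevel.IsPadicallyAutomorphic ρ` is a CONTINUOUS `ℚ̄_p`-point `x` of the big
Hecke algebra `𝕋(K^p) = (closure 𝕋^S).topologicalClosure ⊂ ∏_{(r,s,i)} End(H^i(X_{U_r}, ℤ/p^s))` (product of
DISCRETE rings). Continuity says exactly: `x mod p^s` factors through a FINITE level of the tower, for every `s`
(`finiteLevelFactorization`, PROVED below) — and "`x` is classical of weight `λ`, level `𝔫`" is EQUALLY a tower
statement: `x mod p^s` factors through the Hecke algebra of the finite-dimensional classical receptacle
`H^q(S_{K_f(𝔫)}, Ẽ_λ(ℚ̄_p))` (`ResGLnCohomology.levelCohomology`) for every `s`, the converse limit step being free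
because that Hecke algebra is finite (`stub_exactOccupancy`, "First lemma"). The line matches the two towers
LEVEL BY LEVEL inside FINITE Hecke algebras: strip the `p`-power level into finitely many classical weights at tame
level (`stub_tameLevelStripping`: Scholze/Emerton–Reduzzi–Xiao torsion lifting + Hida–Katz density), then EXCHANGE
the weights, under crystallinity of `ρ`, for the one weight `λ` (`stub_weightExchange` = the tower of mod-`p^s`
weight isolation + lowering statements `C_s`: Chen–Kiming–Wiese's open question sharpened by torsion `p`-adic Hodge
theory — THE HEART), glue (`stub_exactOccupancy`) and exit by the Eichler–Shimura–Harder dictionary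
(`stub_eichlerShimuraHarder`, irreducibility excludes Eisenstein classes). NO eigenvector in completed cohomology,
NO occupancy (K0), NO degree bookkeeping, NO parallel/non-parallel case split: the three deaths of the dead lines
`Sketch` / `LadderCollapse` cannot occur in this skeleton (see `Lines/Sketch-dead.md`, `Lines/LadderCollapse-dead.md`).

**Statements are LATTICE-FREE ("relation currency").** "`x mod p^s` factors through the Hecke algebra of `M`" is
typed as: every INTEGRAL non-commutative polynomial relation among the good `T_{v,i}` on `M` holds for the values
`x(T_{v,i})` up to `p^{-s}` (`FactorsThroughWeightModP`, `FactorsThroughClassicalModP`; Mathlib `FreeAlgebra.lift`,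
`FreeAlgebra.equivMonoidAlgebraFreeMonoid`, `MonoidAlgebra.coeff`). No `𝒪`-lattice in `H^q` is needed (the subring
generated by the operators does not depend on a lattice), nilpotents of `𝕋(K^p)` are invisible (only VALUES of `x`
enter), and vacuity is excluded in both directions: a zero receptacle / the empty family makes the predicate FALSE
via `P = 1` (`not_factorsThroughClassicalModP_empty`, proved), and a genuinely classical `x` satisfies it at every
precision (`factorsThroughWeightModP_of_isClassicalOfWeight`, proved). Everywhere `𝔫 ≠ 0` (at `𝔫 = 0` the guard
`¬ v ∣ 𝔫` would empty the eigen-equations) and the eigen-equations avoid `𝒰.bad` (`TameLevel.heckeT` is junk `0`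
there) and the divisors of `𝔫` (`ResGLnCohomology.heckeT` is spherical exactly at `v ∤ 𝔫`).

**Composition.** `CrystallineProModularClassical_of : CrystallineProModularClassical` (BY NAME):
`hpm_point_integral` (landed: an INTEGRAL continuous associated point) → `finiteLevelFactorization` (proved) →
`stub_tameLevelStripping` → `stub_weightExchange` → `stub_exactOccupancy` → `stub_eichlerShimuraHarder`.
Six registered stubs after lead rev 3 — S2 `stub_tameLevelStripping` (level `𝔫p^r`, `r` growing
with the precision: the fixed-level form implied Leopoldt's conjecture, S2 worker 12:37Z),
S3 `stub_weightExchange` (hypothesis matched to S2's output), S4-fd + S4 (LANDED, imported),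
S5-lit `stub_harder1987` (Harder 1987 named fact, literature debt) + S5 `stub_eichlerShimuraHarder`
(the fact as first hypothesis — LANDED p161314, rev 4 imports it); rev 5: S2' takes the two named facts stated by
wave 2 (`Scholze2015_gl2TowerHeckeRelations_classical`, `heckeRelations_definedOverInt`) as leading
hypotheses, fed by the literature-debt stubs `stub_scholze2015TowerRelations`, `stub_heckeRelationsOverInt`;
rev 6: S2' LANDED (p165817) and imported.  `sorry` only inside the FOUR open ones: S3' `stub_weightExchange`
(the heart = the crux restricted to nothing) and the three named-fact debts `stub_scholze2015TowerRelations`,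
`stub_heckeRelationsOverInt`, `stub_harder1987`.

**Disproof used** (`Cruxes/CrystallineProModularClassical/Disproof.lean`, gen 1 cycle 1, read in full; landed
`Theorems/CrystallineProModularClassical/Negative/LoadBearing.lean` imported here as the scratch check): §0
`crux_of_langlands` — no `_false_without_H` theorem exists or can exist, so the refutable statements of this line are
its STUBS (§5 NEXT), typed here over existing declarations; §1g irreducibility (load-bearing): consumed by
`stub_weightExchange` (reducible tower points = Eisenstein towers need not exchange) and ESSENTIAL in
`stub_eichlerShimuraHarder` (Eisenstein exclusion; cf. `not_isIrreducible_of_borelFrame`); §1h crystallinity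
(load-bearing): consumed ONLY by `stub_weightExchange` — the line uses `H_crys` at S3 and nowhere else, and the §1h
twist family `ρ_f ⊗ ⟨ε⟩^t` fails S3's conclusion exactly because its truncations stop being torsion-crystalline of
weight `λ`; §1a `hunr`: unused (decoration, as proved there); §1b pro-modularity: consumed in its native finite form
(S1 proved + S2); §1d′ (regularity vacuous off the HT locus): harmless — regularity enters S3 only together with the
crystalline conjunct, verbatim as in the crux; §3 `CruxOverQ`: over `ℚ` S2 = Katz–Hida + Eichler–Shimura and S3 is a
corollary of Emerton 2011 / Pan II by König + Liu (TRIAGE-r2-1 doubt 3) — consistent; §4 `hpm_point_integral`: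
USED (first line of the composition); §5 HAZARD (point ≠ occurrence, K0): DISSOLVED — no stub forms `H̃[𝔭_x]`; the
only eigenvector of the line lives in a finite-dimensional classical receptacle AFTER the exchange. Negatives index
(4 entries: SplitPrimeInduction ×2, OrdinaryPrimeTransport `n = 0` door, K3 anchor): no stub is an instance
(`n = 2` is fixed in every stub; no RS pole count; no deinduction).
-/

namespace Summit.Langlands.Langlands.Cruxes.CrystallineProModularClassical.TorsionWeightExchange

set_option linter.dupNamespace false
set_option linter.unusedVariables false

open Summit.Langlands.Langlands.Theses.EisensteinGelfandKirillov
open Literature.NumberTheory.Automorphic Literature.NumberTheory.GaloisRepresentations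
open Literature.NumberTheory.Automorphic.BigHeckeGLn Literature.NumberTheory.PAdicHodge
open Summit.Langlands.Langlands.Theorems.ProModularOrdinaryClassical.Negative (hpm_point_integral)
open NumberField IsDedekindDomain Filter
open scoped Classical

noncomputable section

variable {F : Type} [Field F] [NumberField F] {p : ℕ} [Fact p.Prime]

/-! ## 0. Vocabulary and proved glue: now the landed module
`Summits.Langlands.Langlands.Theorems.EisensteinGelfandKirillovCrystallineProModularClassicalDefs` (p158196):
`FactorsThroughFiniteLevelModP`, `IsIntegralPoly`, `FactorsThroughClassicalModP`, `FactorsThroughWeightModP`,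
`IsClassicalOfWeight`, `finiteLevelFactorization`, `factorsThroughWeightModP_mono`, `lift_apply_eigenvector`,
`factorsThroughWeightModP_of_isClassicalOfWeight`, `isIntegralPoly_one`, `not_factorsThroughClassicalModP_empty`. -/

/-! ## 0″. Landed stubs (imported): `stub_finiteDimensional_levelCohomology` (S4-fd, p159327, UNCONDITIONAL —
Borel–Serre is the tree theorem `…HeckeEigenvalueField.Res.borelSerre1973_finiteDimensional_groupCohomology_congruenceSubgroup_holds`),
`stub_exactOccupancy` (S4, p160025; Literature by-product `ResGLnCohomologyHeckeCommute`, p159459),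
`stub_eichlerShimuraHarder` (S5, p161314; Harder's fact through its first binder) and
`stub_tameLevelStripping` (S2, p165817; Scholze-type and rationality facts through its first two binders). -/

/-! ## 1. The registered stubs (the ONLY `sorry`s of the file) -/

/-- **Stub S2-lit-A (LITERATURE DEBT, Scholze 2015): torsion Hecke relations of the `p`-power tower of
`GL₂` over a totally real field are classical modulo nilpotence** — the named fact
`Literature.NumberTheory.Automorphic.BigHeckeGLn.Scholze2015_gl2TowerHeckeRelations_classical`
(`GL2TowerTorsionRelationsClassical.lean`, p165094, stated by this line's wave-2 S2 worker; no `_holds`):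
for `F` totally real, `p ≥ 5`, `p ∤ disc F`, `𝒰 : TameLevel 2 F p` there are `𝔫 ≠ 0` and a UNIFORM
`N ≥ 1` such that for every finite set `J` of tower indices some finite PARALLEL-weight family of
receptacles of level `𝔫p^e` has all its INTEGER Hecke relations `Q` nilpotent of exponent `N` on the
torsion modules `H^i(X_{U_r}, ℤ/p^s)`, `(r,s,i) ∈ J`.  Printed: Scholze, Ann. Math. 182 (2015) Thm. IV.3.1,
Cor. IV.2.2, Cor. V.2.6, §V.4 (consequence form for the tree's tower; one adaptation — Ch. IV for the
Hilbert modular varieties of `G*`, Caraiani–Tamiozzo 2023 Rem. 2.2 — flagged in the fact's docstring).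
Registered as a separate stub (lead reshape rev 5) so that `stub_tameLevelStripping` lands now.
[cite: Scholze2015, Thm. IV.3.1, Cor. IV.2.2, Cor. V.2.6] -/
theorem stub_scholze2015TowerRelations : Literature.NumberTheory.Automorphic.BigHeckeGLn.Scholze2015_gl2TowerHeckeRelations_classical := by
  sorry

/-- **Stub S2-lit-B (LITERATURE DEBT, Grobner–Raghuram / Clozel): the Hecke relations on a finite
parallel-weight family of receptacles of `Res_{K/ℚ} GL_n` are defined over `ℤ`** — the named fact
`Literature.NumberTheory.Automorphic.ResGLnCohomology.heckeRelations_definedOverInt`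
(`ResGLnCohomologyRationalRelations.lean`, p164426; no `_holds`): every `ℚ̄_p`-integral non-commutative
polynomial relation among good `T_{v,i}` on the family is a `𝒪_{ℚ̄_p}`-combination of INTEGER relations
(`E_μ` and `H^q(S_{G'}, ℰ_μ)` are defined over `ℚ(μ) = ℚ` for parallel `μ`: Grobner–Raghuram 2014
Lemma 37–38 after Clozel 1990 §3.5; flatness of `𝒪_{ℚ̄_p}` over `ℤ`).  The bridge between the line's
relation currency (`ℚ̄_p`-integral relations) and every printed torsion-to-classical theorem (integer
Hecke algebras).  Registered as a separate stub (lead reshape rev 5).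
[cite: GrobnerRaghuram2014, §7.1 Lemma 37, §7.2 Lemma 38] [cite: Clozel1990, §3.5] -/
theorem stub_heckeRelationsOverInt : Literature.NumberTheory.Automorphic.ResGLnCohomology.heckeRelations_definedOverInt := by
  sorry

/-! ### S2 `stub_tameLevelStripping` — LANDED (p165817, lead rev 5/6), imported from
`…Theorems.EisensteinGelfandKirillovCrystallineProModularClassicalTameLevelStripping`: stripping the `p`-power
tower into classical PARALLEL-weight receptacles of level `𝔫p^r` (`r` growing with the precision) from the two
named facts fed below by `stub_scholze2015TowerRelations` and `stub_heckeRelationsOverInt`.  History: the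
planner's fixed-level form implied Leopoldt's conjecture (wave-1 S2 worker, evidence 12:37Z); corrected rev 3;
proved modulo the two facts by wave 2 (evidence 14:1xZ). -/

/-- **Stub S3 (XL; THE HEART — the mod-`p^s` WEIGHT EXCHANGE and `p`-LEVEL STRIPPING, "Liu's mirror").**
(Lead rev 3: the hypothesis now takes S2's corrected output — families of level `𝔫p^{r}`, `r = r(s)` — so S3
also strips the `p`-level under crystallinity: Katz–Hida density "level `𝔫p^r` ⇒ tame level `𝔫`, higher
weight" is in print and TW-free, and "crystalline ⇒ prime-to-`p` level in weight `λ`" is part of the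
exchange.)  For `F` totally real and
`p ≥ 5` unramified in `F`: an integral eigensystem `x` of the tower which, to EVERY precision `p^{-s}`, is a
character of the joint Hecke algebra of finitely many classical receptacles of level `𝔫p^{r(s)}`, `𝔫 ≠ 0`
(varying weights `λ_k`, degrees `q_k` and `p`-levels — the output of S2), and whose associated Galois representation `ρ` (`IsAssociated`:
`charpoly ρ(Frob_v) = X² − x(T_{v,1})X + q_v x(T_{v,2})` for `v ∉ S`) is irreducible, totally odd and, at every
`v ∣ p`, CRYSTALLINE for Fontaine's pinned datum with pairwise distinct labelled Hodge–Tate weights (the crux's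
local hypothesis VERBATIM), is — to every precision — a character of the Hecke algebra of ONE classical receptacle
`H^q(S_{K_f(𝔫')}, Ẽ_λ)` (`λ` read off the labelled Hodge–Tate weights by the prover; `𝔫' ≠ 0`, level and degree
free). By König's lemma (finitely many `𝒪_E/p^s`-eigensystems at each precision, `E` the finite coefficient field
of `x`) and T. Liu 2007 (doi:10.1016/j.ansens.2007.05.002: limits of torsion-crystalline representations of
bounded weight are crystalline) this is EQUIVALENT to the tower of FINITE-LEVEL statements `C_s` of the card:
mod-`p^s` weight ISOLATION (a dc-weak eigensystem with integral diamond character is weak of one classical weight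
`k' ≡ k`, modulo `p^{g(s)}` — a control statement for the full Hecke algebra, no `p`-adic Hodge theory; TRIAGE-r2-1
sharpen 1) + weight LOWERING (weak of weight `k' ≡ k` with torsion-crystalline `ρ` of labelled weight `λ` ⇒ weak of
weight `λ` modulo `p^{g(s)}` — torsion Fontaine–Laffaille / Kisin modules, explicit for `2 ≤ k_τ ≤ p−1`:
Gee–Liu–Savitt; TRIAGE-r2-2 sharpen); `s = 1` over `ℚ` = companion forms (Edixhoven 1992 Thm. 4.5, Gross 1990,
Coleman–Voloch) without Taylor–Wiles; `s ≥ 2` = Chen–Kiming–Wiese arXiv:1105.1918 §5.3's open question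
sharpened by the torsion-crystalline hypothesis (Kiming–Rustom–Wiese arXiv:1408.3249 Thm. 3 for the weight bounds);
TRUE in the ordinary (Hida: weights `≡ mod (p−1)p^{s−1}` ⇒ forms `≡ mod p^s`) and finite-slope (Coleman 1997 /
Wan 1998) regimes and, by `R^{cris,λ} = 𝕋_λ`, in the Taylor–Wiles sector; over `ℚ` a corollary of Emerton 2011 /
Pan II. OPEN: infinite slope at a non-Taylor–Wiles (e.g. Eisenstein) `𝔪` over `F ≠ ℚ`. No eigenvector, no
occupancy, no degree bookkeeping, no parallel/non-parallel split (mod-`p^s` Hilbert modular forms of every weight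
exist and are moved by partial Hasse invariants / `θ_τ`: Andreatta–Goren, Diamond–Kassaei arXiv:1612.08725,
Diamond arXiv:2011.14128). -/
theorem stub_weightExchange : ∀ (F : Type) [Field F] [NumberField F], NumberField.IsTotallyReal F → ∀ (p : ℕ) [Fact p.Prime], 5 ≤ p → ¬ ((p : ℤ) ∣ NumberField.discr F) → ∀ (𝒰 : Literature.NumberTheory.Automorphic.BigHeckeGLn.TameLevel 2 F p) (x : Literature.NumberTheory.Automorphic.CompletedCohomologyHeckeAlgebraGLn 𝒰 →+* PadicAlgCl p), (∀ t, ‖x t‖ ≤ 1) → ∀ (𝔫 : Ideal (NumberField.RingOfIntegers F)), 𝔫 ≠ 0 → (∀ s : ℕ, ∃ (r m : ℕ) (lams : Fin m → (F →+* PadicAlgCl p) → Fin 2 → ℤ) (qs : Fin m → ℕ), FactorsThroughClassicalModP 𝒰 x (𝔫 * (Ideal.span {((p : ℕ) : NumberField.RingOfIntegers F)}) ^ r) lams qs s) → ∀ (ρ : Literature.NumberTheory.GaloisRepresentations.FramedGaloisRep F (PadicAlgCl p) 2), ρ.toGaloisRep.IsIrreducible → ρ.IsOdd → 𝒰.IsAssociated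 x ρ → (∀ (v : IsDedekindDomain.HeightOneSpectrum (NumberField.RingOfIntegers F)) (hv : ((p : ℕ) : NumberField.RingOfIntegers F) ∈ v.asIdeal), (Literature.NumberTheory.PAdicHodge.fontainePstAdicCompletion v p hv).IsCrystallineFramed (ρ.toLocal v) ∧ (letI := (Literature.NumberTheory.PAdicHodge.fontainePstAdicCompletion v p hv).algebra; Literature.NumberTheory.GaloisRepresentations.GaloisRep.IsLabelledHodgeTateRegular (Literature.NumberTheory.PAdicHodge.fontainePstAdicCompletion v p hv).𝔅 (ρ.toLocal v).toGaloisRep)) → ∃ (𝔫' : Ideal (NumberField.RingOfIntegers F)) (lam : (F →+* PadicAlgCl p) → Fin 2 → ℤ) (q : ℕ), 𝔫' ≠ 0 ∧ ∀ s : ℕ, FactorsThroughWeightModP 𝒰 x 𝔫' lam q s := by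
  sorry

/-- **Stub S5-lit (LITERATURE DEBT, Harder 1987): Hecke eigensystems in the cohomology of
`Res_{F/ℚ} GL₂` with algebraic coefficients are cuspidal cohomological or Eisenstein** — the named fact
`Literature.NumberTheory.Automorphic.ResGLnCohomology.Harder1987_eigensystem_cuspidalOrEisenstein`
(`Literature/NumberTheory/Automorphic/ResGL2EigensystemCuspidalOrEisenstein.lean`, p159515, stated by
this line's S5 worker; no `_holds` in the tree): for `F` totally real, `𝔫 ≠ 0`, any `λ`, `q`,
`E ≃+* ℂ`, a non-zero a.e.-`T_{w,1}, T_{w,2}`-eigenclass of `ResGLnCohomology.levelCohomology E 2 F 𝔫 λ q`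
carries the eigensystem of a regular algebraic CUSPIDAL `π₀` (Satake identities) OR of a pair of
algebraic Größencharaktere (Eisenstein / residual classes).  Printed: Harder, Invent. Math. 89 (1987)
§2.6 Thm. 1, §3.1–3.2, §4.2 Thm. 2 (`H = H_! ⊕ H_Eis`, boundary cohomology induced from the torus);
Franke 1998 Thm. 18 / Franke–Schwermer 1998 (the `A_G(ℝ)°K_∞°`-model).  Registered as a separate stub
(lead reshape rev 3, same treatment as the Borel–Serre debt S4-fd) so that the dictionary stub
`stub_eichlerShimuraHarder` (Eisenstein exclusion by Chebotarev + Brauer–Nesbitt, C→L twist, Satake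
normalisation — all proved) lands now and the analytic debt is ONE named, machine-visible obligation.
[cite: Harder1987, §2.6 Thm. 1, §3.2 Prop. 3.2.4, §4.2 Thm. 2] [cite: Franke1998, Thm. 18] -/
theorem stub_harder1987 : Literature.NumberTheory.Automorphic.ResGLnCohomology.Harder1987_eigensystem_cuspidalOrEisenstein := by
  sorry

/-! ### S5 `stub_eichlerShimuraHarder` — LANDED (p161314, lead rev 3/4), imported from
`…Theorems.EisensteinGelfandKirillovCrystallineProModularClassicalEichlerShimuraHarder`: the Eichler–Shimura–Harder
dictionary with Eisenstein exclusion from `ResGLnCohomology.Harder1987_eigensystem_cuspidalOrEisenstein` (first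
hypothesis, fed below by `stub_harder1987`). -/

/-! ## 2. The composition (pure logic; no `sorry` below this line) -/

/-- **The line closes the crux modulo its four stubs.** From the crux's `∃ 𝒰, IsPadicallyAutomorphic ρ` take
an INTEGRAL continuous associated point `x` (`hpm_point_integral`, landed); `finiteLevelFactorization` (proved)
turns continuity into finite-level factorisation `mod p^s` for all `s`; S2 strips the `p`-power level into
finitely many classical weights at one level `𝔫 ≠ 0`; S3 (the heart) exchanges them, under crystallinity of
`ρ`, for ONE weight `λ` at every precision; S4-fd (Borel–Serre) makes the weight-`λ` receptacle
finite-dimensional and S4 glues the tower of approximate occurrences in it into an exact eigenclass; S5 is the Eichler–Shimura–Harder dictionary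
(irreducibility excludes Eisenstein classes), fed with `S = 𝒰.bad` and `a = (x(T_{v,i}))`, for which
`𝒰.IsAssociated x ρ` is `IsAssociatedFamily` by definition. Concludes
`Summit.Langlands.Langlands.Theses.EisensteinGelfandKirillov.CrystallineProModularClassical` BY NAME.
The crux's `hur` is not used (decoration, Disproof §1a). -/
theorem CrystallineProModularClassical_of : CrystallineProModularClassical := by
  intro F _ _ hF p _ hp hdisc hcpt ι ρ hirr hodd hur hpm hloc
  obtain ⟨𝒰, x, hx, hass, hint⟩ := hpm_point_integral hpm
  have hfin : ∀ s : ℕ, FactorsThroughFiniteLevelModP 𝒰 x s := finiteLevelFactorization 𝒰 x hx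
  obtain ⟨𝔫, h𝔫, hclass⟩ :=
    stub_tameLevelStripping stub_scholze2015TowerRelations stub_heckeRelationsOverInt F hF p hp hdisc 𝒰 x hint hfin
  obtain ⟨𝔫', lam, q, h𝔫', hw⟩ :=
    stub_weightExchange F hF p hp hdisc 𝒰 x hint 𝔫 h𝔫 hclass ρ hirr hodd hass hloc
  have hfd := stub_finiteDimensional_levelCohomology F hF p 𝔫' h𝔫' lam q
  obtain ⟨c, hc, heig⟩ := stub_exactOccupancy F p 𝒰 x 𝔫' h𝔫' lam q hfd hw
  exact stub_eichlerShimuraHarder stub_harder1987 F hF p hcpt ι ρ hirr 𝒰.bad 𝒰.bad_finite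
    (fun v i => x (𝒰.heckeT v i)) hass 𝔫' h𝔫' lam q c hc
    (fun v hv hvn i _ _ => heig v hv hvn i)

end

end Summit.Langlands.Langlands.Cruxes.CrystallineProModularClassical.TorsionWeightExchange
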